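import Summits.QuantumFields.BalabanUV.Beta.EriceFlowEnclosureB12AsPrintedHistoryContagionShiftFlowRepinOpenEnd
import Summits.QuantumFields.BalabanUV.Beta.EriceFlowEnclosureB12AsPrintedHistoryContagionShiftFlowPicardFunctional

/-!
# Beta / EriceFlowEnclosureB12AsPrintedHistoryContagionShiftFlowRepinOpenLipschitz — ASYMPTOTIC FREEDOM IS CONTAGIOUS, part 30: THE SOLUTION OPERATOR IS LIPSCHITZ ON THE OPEN
# BALL AT ONE THRESHOLD, WITH THE FULL RATE.  Part 22 (`abs_sub_le_on_ball`) compared the box solutions of two functionals B′, B″ in the η₀-ball around B through references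
# pinned at a FIXED g₁ above the pin e (two thresholds; the solutions from e then carry only a QUARTER of the perturbed rate β₁ = (β* − 4η₀)∕4, and the Lipschitz constant reads
# `(32∕3)e(e² + 1∕β₁)`).  With part 27 each perturbed functional's solution from e is its own reference AT e and EVERY box solution from e equals it, carrying the rate
# (β* − 4η)∕4 ≥ (β* − 4η₀)∕4 from the pin itself; part 16's `abs_sub_le_of_functional_close` then gives (§46) **`|h′(m) − h″(m)| ≤ (32∕3)·e·(e² + 1∕(β* − 4η₀))·sup|B′ − B″|`**
# uniformly in the scale, for ANY box solutions h′ of B′ and h″ of B″ from e — ONE threshold in the pin and the constant's 1∕β-term divided by four (`abs_sub_le_on_ball_samePin`).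
# §47 reads it on the as-printed carrier: from `Theorem2Statement S hL` (a HYPOTHESIS) + `hrg` + NE4 + moduli for ONE Setting, the solution operator of the limit RG equation
# is LOCALLY LIPSCHITZ on the open sup-norm ball of radius b∕8 around `betaInf S.β`, at every pin g ≤ g₁₈, with `K = (32∕3)g₁₈(g₁₈² + 2∕b)` (part 22: `(32∕3)g₁₆(g₁₆² + 8∕b)` and two
# thresholds) — node U2's `memFlow_stability ∕ memFlow_lipschitz_functional` floor-free on an open set, one threshold.
# Abstract in B, B′, B″ (β-flow team, prover 1, unit `b2b-balaban-beta-bflow-p1`, gen 38; ROW AP-I·Uc × NODE U2 — the open END, Lipschitz form)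

HONEST FRAMING (page 1 of everything the β sub-cell writes): discharging `BetaPertH` makes Bałaban's UV stability UNCONDITIONAL — a
real constructive-QFT result; it is NOT the continuum limit and NOT the Clay problem.  HONEST DEPENDENCY (cell reorg 2026-08-19,
verbatim): «continuum YM on T⁴ ⇐ BetaPertH ∧ nine spine estimates (0/9 proved); BetaPertH ⇐ (D1) ∧ (D4) ∧ CAP+tail; G-an2-4 gates
asym, D1 and NE2/3/4.»  THIS MODULE DISCHARGES NOTHING: it is BOOKKEEPING BY NAME (part 27's `memFlow_solution_of_close`, part 16's `abs_sub_le_of_functional_close`, part 15's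
`reference_of_typedTheorem2`, part 11's `flow_threshold_exists`, node U2's `memoryProfile_betaInf`) over node U2's HYPOTHESIS SHAPES on ABSTRACT functionals `B, B′, B″`;
`Theorem2Statement S hL` ([I] THEOREM 2 p. 259, STATED WITHOUT PROOF — typed, NOT proved anywhere in the tree), `hrg` ((0.20) p. 256), NE4 `ScaleShiftRate` (GAPS G-t4-U2-1,
p. 298), `HistLipschitz` ∕ `FadingMemory` (GAPS G-t4-U2-2) are HYPOTHESES about an abstract `S : Setting`; the perturbations are ABSTRACT functionals with displayed profiles and
displayed sup-closeness — none of this is asserted for Bałaban's actual β.  [I] = T. Bałaban, Commun. Math. Phys. **109** (1987) 249–301 [Balaban1987RG1].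

WHAT THIS FILE PROVES (0 sorry, 0 def): §46 **`abs_sub_le_on_ball_samePin`**; §47 **`solution_lipschitz_on_ball_oneThreshold_of_typedTheorem2`**.  NOT CLAIMED: Theorem 2;
the optimal radius or constant; anything about Bałaban's β; `BetaPertH`; the continuum limit of the measures; Clay.
-/

namespace Summit.QuantumFields.BalabanUV.Beta.EriceFlowEnclosureB12AsPrintedHistoryContagionShiftFlowRepinOpenLipschitz

open Finset Filter Topology
open Literature.MathematicalPhysics.QuantumFieldTheory.Balaban1983to89
open Literature.MathematicalPhysics.QuantumFieldTheory.Balaban1983to89.B12BetaAsPrinted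
open Literature.MathematicalPhysics.QuantumFieldTheory.Balaban1983to89.FlowStep (RGEqH)
open Literature.MathematicalPhysics.QuantumFieldTheory.Balaban1983to89.T4CouplingMatching (HistLipschitz FadingMemory ScaleShiftRate)
open Literature.MathematicalPhysics.QuantumFieldTheory.Balaban1983to89.T4BetaStationary (SeqBox MemoryProfile betaInf memoryProfile_betaInf)
open Literature.MathematicalPhysics.QuantumFieldTheory.Balaban1983to89.T4BetaFlowWellPosed (MemFlow solution)
open Summit.QuantumFields.BalabanUV.Beta.EriceFlowEnclosureB12AsPrintedHistoryContagionShiftFlowEnd (flow_threshold_exists)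
open Summit.QuantumFields.BalabanUV.Beta.EriceFlowEnclosureB12AsPrintedHistoryContagionShiftFlowPicardEnd (reference_of_typedTheorem2)
open Summit.QuantumFields.BalabanUV.Beta.EriceFlowEnclosureB12AsPrintedHistoryContagionShiftFlowPicardFunctional (abs_sub_le_of_functional_close)
open Summit.QuantumFields.BalabanUV.Beta.EriceFlowEnclosureB12AsPrintedHistoryContagionShiftFlowRepinOpen (memFlow_solution_of_close)

noncomputable section

/-! ## §46 Two functionals in the ball, any box solutions from one pin: Lipschitz at one threshold with the full perturbed rate -/

/-- **THE SOLUTION OPERATOR IS LIPSCHITZ ON THE BALL AT ONE THRESHOLD.**  `B` with memory profile `(C_m, θ)` on ]0, γ]^ℕ and ONE AF reference (t from g*, rate β*, scale t_a);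
two functionals B′, B″ with memory profile `(C_m, θ)`, both within η₀ of B on the box (`4η₀ < β*`), `|B′ − B″| ≤ δ` on the box; a pin `0 < e`, `4e ≤ γ`, below B's threshold
(`4C_m e ≤ β*(1 − θ)`, `e²Q(g*, β*) ≤ 3∕4`, `64C_m e³ ≤ (1 − θ)²`) and with `32C_m e ≤ (β* − 4η₀)(1 − θ)`, `4e²·(C_mγ∕(1 − θ)² + (8C_m∕((1 − θ)(β* − 4η₀)))²) ≤ ½`, `512C_m e³ ≤ (1 − θ)²`,
`C_m(8e³ + 16e∕(β* − 4η₀)) ≤ (1 − θ)²∕4`; ANY box solutions h′ of `MemFlow B′ e ·`, h″ of `MemFlow B″ e ·`.  THEN at every scale m: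
**`|h′(m) − h″(m)| ≤ (32∕3)·e·(e² + 1∕(β* − 4η₀))·δ`** — part 27 identifies h′, h″ with node U2's solutions (profiles `1∕(4e²) + ((β* − 4η₀)∕4)m` from the pin itself), part 16 closes with
B′ as the profiled functional.  Part 22's `abs_sub_le_on_ball` needed a second pin g₁ above e and had `4∕(β* − 4η₀)` in place of `1∕(β* − 4η₀)`. [cite: Balaban1987RG1, Thm 2 (0.31) p.259 with (0.20) p.256 and p.298] -/
theorem abs_sub_le_on_ball_samePin {B B' B'' : (ℕ → ℝ) → ℝ} {Cm θ γ bs ta gs e η₀ δ : ℝ} {t h' h'' : ℕ → ℝ}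
    (hB : MemoryProfile Cm θ γ B) (hB' : MemoryProfile Cm θ γ B') (hB'' : MemoryProfile Cm θ γ B'')
    (hCm : 0 ≤ Cm) (hθ0 : 0 ≤ θ) (hθ1 : θ < 1) (hbs : 0 < bs) (hta : 0 < ta)
    (hts : SeqBox γ t) (htf : MemFlow B gs t) (hprof : ∀ m : ℕ, 1 / ta ^ 2 + bs * (m : ℝ) ≤ 1 / (t m) ^ 2)
    (hη4 : 4 * η₀ < bs) (hη' : ∀ u, SeqBox γ u → |B u - B' u| ≤ η₀) (hη'' : ∀ u, SeqBox γ u → |B u - B'' u| ≤ η₀)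
    (hδ : ∀ u, SeqBox γ u → |B' u - B'' u| ≤ δ)
    (he : 0 < e) (h4e : 4 * e ≤ γ)
    (hs1 : 4 * Cm * e ≤ bs * (1 - θ))
    (hs2 : e ^ 2 * (1 / gs ^ 2 + Cm * γ / (1 - θ) ^ 2 + (2 * Cm / ((1 - θ) * bs)) ^ 2) ≤ 3 / 4)
    (hs4 : 64 * Cm * e ^ 3 ≤ (1 - θ) ^ 2)
    (hp1 : 32 * Cm * e ≤ (bs - 4 * η₀) * (1 - θ))
    (hp2 : 4 * e ^ 2 * (Cm * γ / (1 - θ) ^ 2 + (8 * Cm / ((1 - θ) * (bs - 4 * η₀))) ^ 2) ≤ 1 / 2)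
    (hp4 : 512 * Cm * e ^ 3 ≤ (1 - θ) ^ 2)
    (hs6 : Cm * (8 * e ^ 3 + 16 * e / (bs - 4 * η₀)) ≤ (1 - θ) ^ 2 / 4)
    (hhs' : SeqBox γ h') (hhf' : MemFlow B' e h') (hhs'' : SeqBox γ h'') (hhf'' : MemFlow B'' e h'') (m : ℕ) :
    |h' m - h'' m| ≤ 32 / 3 * e * (e ^ 2 + 1 / (bs - 4 * η₀)) * δ := by
  have hbη : 0 < bs - 4 * η₀ := by linarith
  -- part 27 for B′ and for B″: the box solutions from e ARE node U2's solutions, with the rate (β* − 4η₀)∕4 from the pin itself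
  obtain ⟨-, -, hprof', -, huniq'⟩ :=
    memFlow_solution_of_close hB hB' hCm hθ0 hθ1 hbs hta hts htf hprof hη' hη4 he h4e hs1 hs2 hs4 hp1 hp2 hp4
  obtain ⟨-, -, hprof'', -, huniq''⟩ :=
    memFlow_solution_of_close hB hB'' hCm hθ0 hθ1 hbs hta hts htf hprof hη'' hη4 he h4e hs1 hs2 hs4 hp1 hp2 hp4
  have hP' : ∀ q : ℕ, 1 / (4 * e ^ 2) + (bs - 4 * η₀) / 4 * (q : ℝ) ≤ 1 / (h' q) ^ 2 := fun q => by
    rw [huniq' h' hhs' hhf']; exact hprof' q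
  have hP'' : ∀ q : ℕ, 1 / (4 * e ^ 2) + (bs - 4 * η₀) / 4 * (q : ℝ) ≤ 1 / (h'' q) ^ 2 := fun q => by
    rw [huniq'' h'' hhs'' hhf'']; exact hprof'' q
  exact abs_sub_le_of_functional_close hB' hCm hθ0 hθ1 hbη he hδ hhs' hhs'' hhf' hhf'' hP' hP'' hs6 m

/-! ## §47 The carrier: the solution operator of the limit RG equation is locally Lipschitz on the open ball, one threshold -/

variable {S : Setting}

/-- **THE SOLUTION OPERATOR OF THE LIMIT RG EQUATION IS LOCALLY LIPSCHITZ ON THE OPEN BALL, AT ONE THRESHOLD — FROM THEOREM 2 AS TYPED FOR ONE SETTING.**  `Theorem2Statement S hL`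
(a HYPOTHESIS), the binder `hrg` on ]0, γ_u], NE4 `ScaleShiftRate c θ γ_u S.β` (c ≥ 0), `HistLipschitz Λ γ_u S.β` with `FadingMemory C θ Λ` (0 < θ < 1, C ≥ 0; γ_u ARBITRARY) ⟹
for every torus exponent m there are η₀ = b∕8 > 0, g₁₈ > 0 and `K = (32∕3)g₁₈(g₁₈² + 2∕b)` such that for EVERY two functionals B′, B″ with `MemoryProfile C θ γ_u`, both within η₀ of
`betaInf S.β` on the box and `|B′ − B″| ≤ δ` there, EVERY pin g ∈ ]0, g₁₈] and ANY box solutions h′ of `MemFlow B′ g ·`, h″ of `MemFlow B″ g ·`: **`|h′(m′) − h″(m′)| ≤ K·δ` at every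
scale** — part 22's two thresholds merged and its `8∕b` replaced by `2∕b`.  Theorem 2 is NOT asked of the perturbations. [cite: Balaban1987RG1, Thm 2 (0.31) p.259 with (0.20) p.256 and §5 p.298] -/
theorem solution_lipschitz_on_ball_oneThreshold_of_typedTheorem2 {hL : Odd S.L ∧ 1 < S.L} (h : Theorem2Statement S hL)
    {γu θ C c : ℝ} {Λ : ℕ → ℕ → ℝ} (hγu : 0 < γu)
    (hrg : ∀ P : B12.RunParams, Step.InInterval γu P.K (S.cpl P) → RGEqH P.K S.β (S.cpl P))
    (hS : ScaleShiftRate c θ γu S.β) (hL' : HistLipschitz Λ γu S.β) (hΛ : FadingMemory C θ Λ)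
    (hθ0 : 0 < θ) (hθ1 : θ < 1) (hC : 0 ≤ C) (hc : 0 ≤ c) (m : ℕ) :
    ∃ η₀ g₁₈ K : ℝ, 0 < η₀ ∧ 0 < g₁₈ ∧ 0 ≤ K ∧ ∀ (B' B'' : (ℕ → ℝ) → ℝ) (δ : ℝ), MemoryProfile C θ γu B' → MemoryProfile C θ γu B'' →
      (∀ u : ℕ → ℝ, SeqBox γu u → |betaInf S.β u - B' u| ≤ η₀) → (∀ u : ℕ → ℝ, SeqBox γu u → |betaInf S.β u - B'' u| ≤ η₀) →
      (∀ u : ℕ → ℝ, SeqBox γu u → |B' u - B'' u| ≤ δ) →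
      ∀ (g : ℝ) (h' h'' : ℕ → ℝ), 0 < g → g ≤ g₁₈ → SeqBox γu h' → MemFlow B' g h' → SeqBox γu h'' → MemFlow B'' g h'' →
      ∀ m' : ℕ, |h' m' - h'' m'| ≤ K * δ := by
  have h1θ : 0 < 1 - θ := by linarith
  have hB := memoryProfile_betaInf hS hL' hΛ hθ0.le hθ1
  obtain ⟨gr, b, -, -, t, hgr, hb, -, -, htbox, htflow, hprof, -, -⟩ := reference_of_typedTheorem2 h hγu hrg hS hL' hΛ hθ0 hθ1 hC hc m
  have h2gr : 0 < 2 * gr := by positivity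
  have h16C : 0 ≤ 16 * C := by positivity
  have hb2 : b - 4 * (b / 8) = b / 2 := by ring
  obtain ⟨e₀, he₀, hthr⟩ := flow_threshold_exists (1 / gr ^ 2 + C * γu / (1 - θ) ^ 2 + (2 * C / ((1 - θ) * b)) ^ 2) hC hθ1 hb
  obtain ⟨e₁, he₁, hthr'⟩ := flow_threshold_exists (6 * (C * γu / (1 - θ) ^ 2 + (8 * C / ((1 - θ) * (b / 2))) ^ 2)) h16C hθ1 hb
  -- the kernel smallness `C(8g³ + 16g∕(b∕2)) ≤ (1−θ)²∕4` below e₂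
  set e₂ : ℝ := min 1 ((1 - θ) ^ 2 / (4 * (C * (8 + 16 / (b / 2))) + 1)) with he₂
  have he₂0 : 0 < e₂ := lt_min one_pos (by positivity)
  have hs6 : ∀ e : ℝ, 0 < e → e ≤ e₂ → C * (8 * e ^ 3 + 16 * e / (b / 2)) ≤ (1 - θ) ^ 2 / 4 := by
    intro e he hle
    have hle1 : e ≤ 1 := hle.trans (min_le_left _ _)
    have hle' : e ≤ (1 - θ) ^ 2 / (4 * (C * (8 + 16 / (b / 2))) + 1) := hle.trans (min_le_right _ _)
    rw [le_div_iff₀ (by positivity)] at hle'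
    have he3 : e ^ 3 ≤ e := by nlinarith [mul_le_mul hle1 hle1 he.le zero_le_one]
    have hK : 0 ≤ C * (8 + 16 / (b / 2)) := by positivity
    calc C * (8 * e ^ 3 + 16 * e / (b / 2)) ≤ C * (8 * e + 16 * e / (b / 2)) := by gcongr
      _ = e * (C * (8 + 16 / (b / 2))) := by ring
      _ ≤ (1 - θ) ^ 2 / 4 := by nlinarith
  set g₁₈ : ℝ := min e₀ (min e₁ (min (γu / 4) e₂)) with hg₁₈
  have hg₁₈0 : 0 < g₁₈ := lt_min he₀ (lt_min he₁ (lt_min (by positivity) he₂0))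
  refine ⟨b / 8, g₁₈, 32 / 3 * g₁₈ * (g₁₈ ^ 2 + 1 / (b / 2)), by positivity, hg₁₈0, by positivity,
    fun B' B'' δ hB' hB'' hη' hη'' hδ g h' h'' hg hle hhs' hhf' hhs'' hhf'' m' => ?_⟩
  have hη4 : 4 * (b / 8) < b := by linarith
  obtain ⟨hs1, hs2, hs4⟩ := hthr g hg (hle.trans (min_le_left _ _))
  obtain ⟨hs1', hs2', hs4'⟩ := hthr' g hg (hle.trans ((min_le_right _ _).trans (min_le_left _ _)))
  have h4g : 4 * g ≤ γu := by linarith [hle.trans ((min_le_right _ _).trans ((min_le_right _ _).trans (min_le_left _ _)))]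
  have hs6g := hs6 g hg (hle.trans ((min_le_right _ _).trans ((min_le_right _ _).trans (min_le_right _ _))))
  have hp1 : 32 * C * g ≤ (b - 4 * (b / 8)) * (1 - θ) := by rw [hb2]; nlinarith [mul_nonneg hC hg.le]
  have hp2 : 4 * g ^ 2 * (C * γu / (1 - θ) ^ 2 + (8 * C / ((1 - θ) * (b - 4 * (b / 8)))) ^ 2) ≤ 1 / 2 := by rw [hb2]; linarith
  have hp4 : 512 * C * g ^ 3 ≤ (1 - θ) ^ 2 := by nlinarith [mul_nonneg hC (pow_nonneg hg.le 3)]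
  have hs6' : C * (8 * g ^ 3 + 16 * g / (b - 4 * (b / 8))) ≤ (1 - θ) ^ 2 / 4 := by rw [hb2]; exact hs6g
  have hδ0 : 0 ≤ δ := (abs_nonneg _).trans (hδ t htbox)
  have hk := abs_sub_le_on_ball_samePin hB hB' hB'' hC hθ0.le hθ1 hb h2gr htbox htflow hprof hη4 hη' hη'' hδ hg h4g hs1 hs2 hs4 hp1 hp2 hp4
    hs6' hhs' hhf' hhs'' hhf'' m'
  rw [hb2] at hk
  have hg0 : 0 ≤ g₁₈ := hg₁₈0.le
  clear_value g₁₈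
  have hmono : 32 / 3 * g * (g ^ 2 + 1 / (b / 2)) ≤ 32 / 3 * g₁₈ * (g₁₈ ^ 2 + 1 / (b / 2)) := by
    have h1 : g ^ 2 ≤ g₁₈ ^ 2 := pow_le_pow_left₀ hg.le hle 2
    have h2 : 0 ≤ g ^ 2 + 1 / (b / 2) := by positivity
    calc 32 / 3 * g * (g ^ 2 + 1 / (b / 2)) ≤ 32 / 3 * g₁₈ * (g ^ 2 + 1 / (b / 2)) :=
          mul_le_mul_of_nonneg_right (mul_le_mul_of_nonneg_left hle (by norm_num)) h2
      _ ≤ 32 / 3 * g₁₈ * (g₁₈ ^ 2 + 1 / (b / 2)) :=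
          mul_le_mul_of_nonneg_left (add_le_add h1 le_rfl) (mul_nonneg (by norm_num) hg0)
  exact hk.trans (mul_le_mul_of_nonneg_right hmono hδ0)

end

end Summit.QuantumFields.BalabanUV.Beta.EriceFlowEnclosureB12AsPrintedHistoryContagionShiftFlowRepinOpenLipschitz
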